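import Literature.NumberTheory.LFunctions.FordVinogradovBridge
import Literature.NumberTheory.LFunctions.FordExpSumSmallLambda
import HarnessLib

/-!
# Rows of Ford's Table 6.1: from explicit mean-value constants to Theorem 2 on one `λ`-interval

Topic `Literature/NumberTheory/LFunctions`.  Everything in this file is PROVED; no definition and
no named fact is introduced.

K. Ford, *Vinogradov's integral and bounds for the Riemann zeta function*, Proc. LMS 85 (2002),
proof of Lemma 6.8 (Theorem 2 for `2.6 ≤ λ ≤ 87`): for `λ ∈ [k-1, k]` one takes a row
`(k, n₀, n, C)` of Table 6.1, a bound `J_{nk,k}(P) ≤ C_n P^{2nk - k(k+1)/2 + Δ_n}` (`P ≥ 1`) produced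
by the iterations of Lemmas 6.5/6.7 from the trivial bound, Corollary 6.4 in the form
`S(N,t) ≤ (4 (k!(2πk)^k C_n)^{1/(2nk)} + 2) N^{1-c}`, `c = (1 - (2+2Δ_n)/(k+1))/(2nk)`
(`FordVK.ford_cor64`), and finally (6.6) (`FordVK.bound_transfer`) to trade the surplus of the
exponent `c` over the required `1/(133.66 λ²)` for a small constant.

`FordVK.row_bound` is this deduction for one row, with the mean-value bound as hypothesis `hJ` and
the resulting constant in closed form: for `N^{k-1} ≤ t ≤ N^k`,

  `‖∑_{N<n≤R} (n+u)^{-it}‖ ≤ C₀^{d₁/c} · N^{1 - (log N)²/(133.66 (log t)²)}`,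
  `C₀ = 4 (k!(2πk)^k C_n)^{1/(2nk)} + 2`,  `d₁ = 1/(133.66 (k-1)²) ≤ c`

(pointwise in `(N, t)`: the required saving `d = (log N)²/(133.66 log² t)` is at most `d₁` because
`log t ≥ (k-1) log N`, and `C₀ ≥ 1`).  The certification `C₀^{d₁/c} ≤ C_table` of a row is a
separate numerical step.

## References

* K. Ford, *Vinogradov's integral and bounds for the Riemann zeta function*, Proc. London Math.
  Soc. (3) 85 (2002), 565–633; arXiv:1910.08209. Lemma 6.8 and its proof, Corollary 6.4, (6.6),
  Table 6.1. [Ford2002]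
-/

noncomputable section

open Finset Real Complex

namespace Literature.NumberTheory.LFunctions
namespace FordVK

open VdC VMV

/-- **One row of Table 6.1 from its mean-value constants.** Let `k ≥ 4`, `n ≥ 1`, `C > 0`,
`Δ ≥ 0` with `J_{nk,k}(P) ≤ C P^{2nk - k(k+1)/2 + Δ}` for all real `P ≥ 1`, and put
`c = (1 - (2+2Δ)/(k+1))/(2nk)`, `d₁ = 1/(133.66 (k-1)²)`, `C₀ = 4 (k!(2πk)^k C)^{1/(2nk)} + 2`.
If `d₁ ≤ c`, then for `1 ≤ N < R ≤ 2N`, `0 < u ≤ 1`, `N^{k-1} ≤ t ≤ N^k`: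
`‖∑_{N<n≤R} (n+u)^{-it}‖ ≤ C₀^{d₁/c} N^{1 - (log N)²/(133.66 (log t)²)}`.
[cite: Ford2002, proof of Lemma 6.8 (Corollary 6.4 followed by (6.6))] -/
theorem row_bound {k n N R : ℕ} {t u C Δ : ℝ} (hk : 4 ≤ k) (hn : 1 ≤ n) (hN : 1 ≤ N)
    (hNR : N < R) (hR : R ≤ 2 * N) (hu0 : 0 < u) (hu1 : u ≤ 1) (hC : 0 < C) (hΔ : 0 ≤ Δ)
    (ht1 : (N : ℝ) ^ (k - 1) ≤ t) (ht2 : t ≤ (N : ℝ) ^ k)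
    (hJ : ∀ P : ℝ, 1 ≤ P → (J k (n * k) (Finset.Icc (1 : ℤ) ⌊P⌋₊) : ℝ)
      ≤ C * P ^ ((2 * (n * k) : ℕ) - ((k * (k + 1) / 2 : ℕ) : ℝ) + Δ))
    (hdc : 1 / (133.66 * ((k : ℝ) - 1) ^ 2) ≤ (1 - (2 + 2 * Δ) / (k + 1)) / (2 * ((n * k : ℕ) : ℝ))) :
    ‖∑ n ∈ Ioc N R, ((n : ℂ) + u) ^ (-(t * Complex.I))‖
      ≤ (4 * ((Nat.factorial k : ℝ) * (2 * π * k) ^ k * C) ^ (1 / (2 * ((n * k : ℕ) : ℝ))) + 2)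
            ^ ((1 / (133.66 * ((k : ℝ) - 1) ^ 2)) / ((1 - (2 + 2 * Δ) / (k + 1)) / (2 * ((n * k : ℕ) : ℝ))))
          * (N : ℝ) ^ (1 - Real.log N ^ 2 / (133.66 * Real.log t ^ 2)) := by
  set c : ℝ := (1 - (2 + 2 * Δ) / (k + 1)) / (2 * ((n * k : ℕ) : ℝ)) with hc
  set d₁ : ℝ := 1 / (133.66 * ((k : ℝ) - 1) ^ 2) with hd₁
  set C₀ : ℝ := 4 * ((Nat.factorial k : ℝ) * (2 * π * k) ^ k * C) ^ (1 / (2 * ((n * k : ℕ) : ℝ))) + 2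
    with hC₀
  set S : ℝ := ‖∑ n ∈ Ioc N R, ((n : ℂ) + u) ^ (-(t * Complex.I))‖ with hS
  have hNpos : (0 : ℝ) < N := by exact_mod_cast hN
  have hN1 : (1 : ℝ) ≤ N := by exact_mod_cast hN
  have hk1 : (1 : ℝ) < k := by
    have : (4 : ℝ) ≤ k := by exact_mod_cast hk
    linarith
  have hkm1 : 0 < (k : ℝ) - 1 := by linarith
  have hden : 0 < 133.66 * ((k : ℝ) - 1) ^ 2 := mul_pos (by norm_num) (pow_pos hkm1 2)
  have hd₁pos : 0 < d₁ := by rw [hd₁]; exact div_pos one_pos hden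
  have hC₀1 : 1 ≤ C₀ := by
    rw [hC₀]
    have : 0 ≤ 4 * ((Nat.factorial k : ℝ) * (2 * π * k) ^ k * C) ^ (1 / (2 * ((n * k : ℕ) : ℝ))) := by
      positivity
    linarith
  have hC₀pos : 0 < C₀ := by linarith
  have hcor := ford_cor64 hk hn hN hNR hR hu0 hu1 hC hΔ ht1 ht2 hJ
  rw [← hC₀, ← hc] at hcor
  change S ≤ C₀ * (N : ℝ) ^ (1 - c) at hcor
  have hSN : S ≤ N := norm_shifted_sum_le_trivial hR hu0
  -- the required saving `d` and `d ≤ d₁ ≤ c`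
  set d : ℝ := Real.log N ^ 2 / (133.66 * Real.log t ^ 2) with hd
  rcases eq_or_lt_of_le hN with hN1' | hN2
  · -- `N = 1`: trivial
    have hN1'' : (N : ℝ) = 1 := by exact_mod_cast hN1'.symm
    rw [hN1''] at hSN
    rw [hN1'', Real.one_rpow, mul_one]
    exact hSN.trans (Real.one_le_rpow hC₀1 (div_nonneg hd₁pos.le (hd₁pos.le.trans hdc)))
  have hN2' : (2 : ℝ) ≤ N := by exact_mod_cast hN2
  have hlogN : 0 < Real.log N := Real.log_pos (by linarith)
  have ht0 : 1 < t := by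
    calc (1 : ℝ) < N := by linarith
      _ = (N : ℝ) ^ 1 := (pow_one _).symm
      _ ≤ (N : ℝ) ^ (k - 1) := pow_le_pow_right₀ hN1 (by omega)
      _ ≤ t := ht1
  have hlogt : Real.log ((N : ℝ) ^ (k - 1)) ≤ Real.log t := Real.log_le_log (by positivity) ht1
  rw [Real.log_pow] at hlogt
  have hlogt0 : 0 < Real.log t := Real.log_pos ht0
  have hdpos : 0 < d := by rw [hd]; positivity
  have hdd₁ : d ≤ d₁ := by
    rw [hd, hd₁, div_le_div_iff₀ (by positivity) hden, one_mul]
    have hk' : ((k - 1 : ℕ) : ℝ) = (k : ℝ) - 1 := by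
      rw [Nat.cast_sub (by omega)]; simp
    rw [hk'] at hlogt
    have h0 : 0 ≤ ((k : ℝ) - 1) * Real.log N := by positivity
    calc Real.log N ^ 2 * (133.66 * ((k : ℝ) - 1) ^ 2) = 133.66 * (((k : ℝ) - 1) * Real.log N) ^ 2 := by ring
      _ ≤ 133.66 * Real.log t ^ 2 := by
          refine mul_le_mul_of_nonneg_left (pow_le_pow_left₀ h0 hlogt 2) (by norm_num)
  have hbt := bound_transfer hSN hN1 hC₀pos hdpos (hdd₁.trans hdc) hcor
  -- `C₀^{d/c} ≤ C₀^{d₁/c}`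
  have hcpos : 0 < c := lt_of_lt_of_le hd₁pos hdc
  have hexp : C₀ ^ (d / c) ≤ C₀ ^ (d₁ / c) :=
    Real.rpow_le_rpow_of_exponent_le hC₀1 (div_le_div_of_nonneg_right hdd₁ hcpos.le)
  calc S ≤ C₀ ^ (d / c) * (N : ℝ) ^ (1 - d) := hbt
    _ ≤ C₀ ^ (d₁ / c) * (N : ℝ) ^ (1 - d) := mul_le_mul_of_nonneg_right hexp (by positivity)

end FordVK
end Literature.NumberTheory.LFunctions
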